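import Summits.NavierStokesRegularity.FluidComputer.PalasekTowerGermHostStrictTiny

/-!
# The tiny blob, VI: an EXPLICIT strain point — the strict slot's carrier scale becomes a number

Cell `ns-blowup`, seat `ns-blowup-ecbridge-3` (g5); GROUP C «BRIDGE SUPPORT» of the route
`PalasekTowerBreakdown` (crux `EpisodeBaseG`, item stmt-NavierStokesRegularity-19179, R2; line `slot` v4 and
the holder's draft line `explicit` v5). Sequel of `PalasekTowerTinyHosts.lean` (ecbridge-4 g3: the tiny profile
`U_a = Y₀ • B_a`, its weak slot) and `PalasekTowerGermHostStrictTiny.lean` (ecbridge-3 g3: the strict profile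
`strictTinyProfile a = U_a + farPusher`, `LevelZeroData (strictTinyProfile a) 7`). LABEL: E–C typing (KERNEL
calculus: one explicit point — a definition with body — and its consequences; everything proved). WHAT THIS IS
NOT: not Navier–Stokes evidence — the Jacobian of one explicit vector field at one explicit point and the
register's level-`0` strain bookkeeping; no flow, stage, episode or blow-up.

## Why (refuter4 K97 (2)(i), 2026-08-26)

The admissible carrier scale of the tree's only strict-slot inhabitant was `a ≤ strainConst/256` with
`strainConst = ‖DB₁(strainPt)‖`, `strainPt := exists_strainPt.choose` — a `Classical.choose` constant of which
only `0 <` is known, so neither `levelZeroData_strictTinyProfile` nor the named scale `strictTinyScale` gives a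
NUMERIC design. Here the strain point is explicit:

* §1 `strainPt₁ = (2/3) e₁` lies in the FLAT ZONE of the unit blob (`s = ‖x₁‖² = 4/9 < 1/2`, where
  `G = −6s + 6s²`, `G′ = −6 + 12s`, `F′ = 2G + sG′`), and the Jacobian of `B₁` there maps
  `e₁ ↦ 2 F′(4/9) ⟪x₁, e₁⟫ e₃ = −(352/81) e₃` (`fderiv_tinyBlob_one_strainPt₁_e₁`), whence
  **`‖DB₁(x₁)‖ ≥ 352/81 ≈ 4.35`** (`le_norm_fderiv_tinyBlob_one_strainPt₁`) and, by scaling,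
  `‖DB_a(a x₁)‖ ≥ 352/(81 a)`;
* §2 the strain floor `A₀ = 256·Y₀ ≤ ‖DU_a(a x₁)‖` for every **`0 < a ≤ 11/648`** (`11/648 = 352/(81·256)`,
  sharp for this point; `1/64 < 11/648 < 5/256`), the weak slot `LevelZeroDataWeak (tinyProfile a) (2a)` and
  THE STRICT SLOT **`LevelZeroData (strictTinyProfile a) 7` for every numeric `0 < a ≤ 11/648`**
  (`Germ.levelZeroData_strictTinyProfile_of_le`), in particular for `a = 1/64`
  (`Germ.levelZeroData_strictTinyProfile_sixtyFourth`); the germ host and the crux reduction for these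
  numeric profiles follow by the slot's API (`hostPreparationD_exact`, `episodeBaseG_of_firstEpisodeD`).

What is still NOT numeric after this file (K97 (2)(ii)(iii)): the line-anchor width `σ₀` (`LevelZeroData.width`)
and the fade length `ε` (`fadeLen`) — both need a sup bound on the NONLOCAL acceleration / germ residual of the
profile — and the anchor value `rate⋆ = ⟪U(0), accel 1 U 0⟫` (`LevelZeroData.rate`).

References: S. Palasek, arXiv:2605.13827 §3.3 (level-`0` host; the strain readout) [cite: Palasek2026ElementaryModel, §3.3];
folklore vector calculus.
-/

noncomputable section

namespace Summit.NavierStokesRegularity.FluidComputer.PalasekTowerClayBridge.TinyBlob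

open Real Set Function Filter Topology InnerProductSpace Metric MeasureTheory
open scoped Topology ContDiff RealInnerProductSpace

open Literature.Analysis.FluidPDE

variable {a : ℝ}

/-! ## §1 The explicit strain point `x₁ = (2/3) e₁` of the unit blob -/

/-- **The explicit strain point** `x₁ = (2/3) e₁` of the unit blob `B₁` (flat zone, equatorial plane). [folklore] -/
def strainPt₁ : EuclideanSpace ℝ (Fin 3) := (2 / 3 : ℝ) • e₁

/-- `(e₁)₂ = 0`. [folklore] -/
theorem e₁_apply_two : e₁ 2 = 0 := by simp [e₁]

/-- Coordinates of `x₁`: `(2/3, 0, 0)`. [folklore] -/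
theorem strainPt₁_apply : strainPt₁ 0 = 2 / 3 ∧ strainPt₁ 1 = 0 ∧ strainPt₁ 2 = 0 := by
  refine ⟨?_, ?_, ?_⟩ <;> simp [strainPt₁, e₁]

/-- `‖x₁‖ = 2/3`. [folklore] -/
theorem norm_strainPt₁ : ‖strainPt₁‖ = 2 / 3 := by
  rw [strainPt₁, norm_smul, show ‖e₁‖ = 1 by simp [e₁], mul_one, Real.norm_eq_abs, abs_of_pos (by norm_num)]

/-- `‖x₁‖ ≤ 2` (inside the blob's ball `B̄(0, 2)`). [folklore] -/
theorem norm_strainPt₁_le : ‖strainPt₁‖ ≤ 2 := by rw [norm_strainPt₁]; norm_num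

/-- `⟪x₁, e₁⟫ = 2/3`. [folklore] -/
theorem inner_strainPt₁_e₁ : ⟪strainPt₁, e₁⟫ = 2 / 3 := by
  rw [strainPt₁, real_inner_smul_left, real_inner_self_eq_norm_sq, show ‖e₁‖ = 1 by simp [e₁]]; norm_num

/-- The radial variable at `x₁`: `s(x₁) = ‖x₁‖² = 4/9`. [folklore] -/
theorem sqn_one_strainPt₁ : sqn 1 strainPt₁ = 4 / 9 := by
  rw [sqn, norm_strainPt₁]; norm_num

/-- The radial coefficient vanishes on the equatorial plane: `φ₁(x₁) = 0`. [folklore] -/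
theorem blobCoef_one_strainPt₁ : blobCoef 1 strainPt₁ = 0 := by
  rw [blobCoef, strainPt₁_apply.2.2]; simp

/-- `G(4/9) = −40/27` (flat-zone formula `G = −6s + 6s²`). [folklore] -/
theorem blobG_four_ninths : blobG (4 / 9) = -(40 / 27) := by
  rw [blobG_of_le_half (by norm_num)]; norm_num

/-- **`G′ = −6 + 12s` on the open flat zone `s < 1/2`** (`G` agrees with the polynomial `−6s + 6s²` on a
neighbourhood). [folklore] -/
theorem deriv_blobG_of_lt_half {σ : ℝ} (hσ : σ < 1 / 2) : deriv blobG σ = -6 + 12 * σ := by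
  have hev : blobG =ᶠ[𝓝 σ] fun t => -6 * t + 6 * t ^ 2 := by
    filter_upwards [isOpen_Iio.mem_nhds hσ] with t ht using blobG_of_le_half (le_of_lt ht)
  rw [hev.deriv_eq]
  have h : HasDerivAt (fun t : ℝ => -6 * t + 6 * t ^ 2) (-6 * 1 + 6 * ((2 : ℕ) * σ ^ (2 - 1))) σ :=
    ((hasDerivAt_id' σ).const_mul (-6)).add ((hasDerivAt_pow 2 σ).const_mul 6)
  rw [h.deriv]
  norm_num
  ring

/-- `G′(4/9) = −2/3`. [folklore] -/
theorem deriv_blobG_four_ninths : deriv blobG (4 / 9) = -(2 / 3) := by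
  rw [deriv_blobG_of_lt_half (by norm_num)]; norm_num

/-- **THE JACOBIAN OF THE UNIT BLOB AT `x₁`, APPLIED TO `e₁`**: `DB₁(x₁) e₁ = 2F′(4/9)·(2/3) e₃ = −(352/81) e₃`
(`F′ = 2G + sG′ = −88/27` at `s = 4/9`; the radial part drops out on the equatorial plane). [folklore] -/
theorem fderiv_tinyBlob_one_strainPt₁_e₁ :
    fderiv ℝ (tinyBlob 1) strainPt₁ e₁ = (-(352 / 81) : ℝ) • e₃ := by
  rw [(hasFDerivAt_tinyBlob 1 strainPt₁).fderiv]
  show ((2 * blobG (sqn 1 strainPt₁) + sqn 1 strainPt₁ * deriv blobG (sqn 1 strainPt₁)) •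
      ((2 / (1 : ℝ) ^ 2) • ⟪strainPt₁, e₁⟫)) • e₃ -
      (blobCoef 1 strainPt₁ • e₁ +
        (((1 : ℝ) ^ 2)⁻¹ • (strainPt₁ 2 • (deriv blobG (sqn 1 strainPt₁) • ((2 / (1 : ℝ) ^ 2) • ⟪strainPt₁, e₁⟫)) +
          blobG (sqn 1 strainPt₁) • e₁ 2)) • strainPt₁) = _
  rw [sqn_one_strainPt₁, blobG_four_ninths, deriv_blobG_four_ninths, inner_strainPt₁_e₁, blobCoef_one_strainPt₁,
    strainPt₁_apply.2.2, e₁_apply_two]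
  simp only [smul_eq_mul, zero_smul, mul_zero, add_zero, zero_add]
  norm_num

/-- `‖DB₁(x₁) e₁‖ = 352/81`. [folklore] -/
theorem norm_fderiv_tinyBlob_one_strainPt₁_e₁ : ‖fderiv ℝ (tinyBlob 1) strainPt₁ e₁‖ = 352 / 81 := by
  rw [fderiv_tinyBlob_one_strainPt₁_e₁, norm_smul, norm_e₃, mul_one, Real.norm_eq_abs]
  norm_num

/-- **`352/81 ≤ ‖DB₁(x₁)‖`** (operator norm, tested on the unit vector `e₁`). [folklore] -/
theorem le_norm_fderiv_tinyBlob_one_strainPt₁ : 352 / 81 ≤ ‖fderiv ℝ (tinyBlob 1) strainPt₁‖ := by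
  have h := (fderiv ℝ (tinyBlob 1) strainPt₁).le_opNorm e₁
  rw [norm_fderiv_tinyBlob_one_strainPt₁_e₁, show ‖e₁‖ = 1 by simp [e₁], mul_one] at h
  exact h

/-- The Jacobian of `B₁` at `x₁` is nonzero (an explicit witness for `exists_strainPt`). [folklore] -/
theorem fderiv_tinyBlob_one_strainPt₁_ne_zero : fderiv ℝ (tinyBlob 1) strainPt₁ ≠ 0 := by
  intro h
  have := le_norm_fderiv_tinyBlob_one_strainPt₁
  rw [h, norm_zero] at this
  linarith

/-- **Scaling**: `352/(81 a) ≤ ‖DB_a(a x₁)‖` (`DB_a(a y) = a⁻¹ DB₁(y)`). [folklore] -/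
theorem le_norm_fderiv_tinyBlob_strainPt₁ (ha : 0 < a) :
    352 / 81 / a ≤ ‖fderiv ℝ (tinyBlob a) (a • strainPt₁)‖ := by
  rw [fderiv_tinyBlob_eq_inv_smul ha.ne', smul_smul, inv_mul_cancel₀ ha.ne', one_smul, norm_smul, norm_inv,
    Real.norm_eq_abs, abs_of_pos ha, div_eq_inv_mul (352 / 81 : ℝ) a]
  exact mul_le_mul_of_nonneg_left le_norm_fderiv_tinyBlob_one_strainPt₁ (inv_nonneg.2 ha.le)

/-- `‖a x₁‖ = (2/3) a ≤ 2a` for `a ≥ 0`. [folklore] -/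
theorem norm_smul_strainPt₁ (ha : 0 ≤ a) : ‖a • strainPt₁‖ = 2 / 3 * a := by
  rw [norm_smul, Real.norm_eq_abs, abs_of_nonneg ha, norm_strainPt₁, mul_comm]

/-! ## §2 The strain floor, the weak slot and the strict slot at every numeric scale `a ≤ 11/648` -/

/-- **THE STRAIN FLOOR AT THE EXPLICIT POINT**: `A₀ ≤ ‖DU_a(a x₁)‖` for `0 < a ≤ 11/648`
(`‖DU_a(a x₁)‖ = Y₀ ‖DB_a(a x₁)‖ ≥ Y₀ · 352/(81a) ≥ 256 Y₀ = A₀`). [cite: Palasek2026ElementaryModel, §3.3] -/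
theorem strain_tinyProfile_explicit (ha : 0 < a) (h : a ≤ 11 / 648) :
    TowerRates.wide.A 0 ≤ ‖fderiv ℝ (tinyProfile a) (a • strainPt₁)‖ := by
  rw [fderiv_tinyProfile, norm_smul, Real.norm_eq_abs, abs_of_pos (TowerRates.Y_pos _ _),
    Host.wide_A_zero_eq, Host.wide_N_zero, mul_comm]
  have hY := TowerRates.Y_pos TowerRates.wide 0
  rw [mul_le_mul_iff_of_pos_left hY]
  refine le_trans ?_ (le_norm_fderiv_tinyBlob_strainPt₁ ha)
  rw [le_div_iff₀ ha]
  linarith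

/-- **The weak slot at every numeric scale**: `Germ.LevelZeroDataWeak (tinyProfile a) (2a)` for
`0 < a ≤ 11/648` (no `strainConst`). [cite: Palasek2026ElementaryModel, §3.3] -/
theorem levelZeroDataWeak_explicit (ha : 0 < a) (h : a ≤ 11 / 648) :
    Germ.LevelZeroDataWeak (tinyProfile a) (2 * a) where
  smooth := contDiff_tinyProfile a
  support := tsupport_tinyProfile_subset ha
  divFree := isDivFree_tinyProfile ha.ne'
  ceiling := norm_tinyProfile_le ha.ne'
  floor := ⟨0, by simp [ha.le], (norm_tinyProfile_zero a).ge⟩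
  strain := ⟨a • strainPt₁, by rw [norm_smul_strainPt₁ ha.le]; linarith, strain_tinyProfile_explicit ha h⟩
  core := core_tinyProfile ha (h.trans (by norm_num))
  anchor := anchor_tinyProfile ha

end Summit.NavierStokesRegularity.FluidComputer.PalasekTowerClayBridge.TinyBlob

namespace Summit.NavierStokesRegularity.FluidComputer.PalasekTowerClayBridge.Germ

open Real Set Function Filter Topology InnerProductSpace Metric MeasureTheory
open scoped Topology ContDiff RealInnerProductSpace

open Literature.Analysis.FluidPDE TinyBlob

variable {a : ℝ}

/-- **The strain floor of the strict tiny profile at the explicit point** `a x₁` (the pusher vanishes there):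
for `0 < a ≤ 11/648`. [cite: Palasek2026ElementaryModel, §3.3] -/
theorem strain_strictTinyProfile_explicit (ha : 0 < a) (h : a ≤ 11 / 648) :
    ∃ x : EuclideanSpace ℝ (Fin 3), ‖x‖ ≤ 7 ∧ TowerRates.wide.A 0 ≤ ‖fderiv ℝ (strictTinyProfile a) x‖ := by
  have hn : ‖a • strainPt₁‖ = 2 / 3 * a := norm_smul_strainPt₁ ha.le
  refine ⟨a • strainPt₁, by rw [hn]; linarith, ?_⟩
  rw [fderiv_strictTinyProfile_of_norm_lt (by rw [hn]; linarith)]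
  exact strain_tinyProfile_explicit ha h

/-- **THE STRICT SLOT AT EVERY NUMERIC SCALE**: `LevelZeroData (strictTinyProfile a) 7` for every
`0 < a ≤ 11/648` — no `Classical.choose` constant left in the admissible range of the carrier scale
(`11/648 = 352/(81·256) < 5/256`). [cite: Palasek2026ElementaryModel, §3.3] -/
theorem levelZeroData_strictTinyProfile_of_le (ha : 0 < a) (h : a ≤ 11 / 648) :
    LevelZeroData (strictTinyProfile a) 7 where
  smooth := contDiff_strictTinyProfile a
  support := tsupport_strictTinyProfile_subset ha (h.trans (by norm_num))
  divFree := isDivFree_strictTinyProfile ha.ne'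
  ceiling := norm_strictTinyProfile_le ha (h.trans (by norm_num))
  floor := ⟨0, by simp, (norm_strictTinyProfile_zero a).ge⟩
  strain := strain_strictTinyProfile_explicit ha h
  core := core_strictTinyProfile ha (h.trans (by norm_num))
  anchor := anchor_strictTinyProfile ha (h.trans (by norm_num)) 1

/-- **A NUMERIC NAMED PROFILE**: `strictTinyProfile (1/64)` fills the strict slot with radius `7`.
[cite: Palasek2026ElementaryModel, §3.3] -/
theorem levelZeroData_strictTinyProfile_sixtyFourth : LevelZeroData (strictTinyProfile (1 / 64)) 7 :=
  levelZeroData_strictTinyProfile_of_le (by norm_num) (by norm_num)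

/-- The old named scale is admissible too whenever it is `≤ 11/648`; conversely the explicit range contains
`strictTinyScale ⊓ 11/648`: `LevelZeroData (strictTinyProfile (min strictTinyScale (11/648))) 7`. [folklore] -/
theorem levelZeroData_strictTinyProfile_min :
    LevelZeroData (strictTinyProfile (min strictTinyScale (11 / 648))) 7 :=
  levelZeroData_strictTinyProfile_of_le (lt_min strictTinyScale_pos (by norm_num)) (min_le_right _ _)

/-- **Host preparation for the numeric profiles**: the germ schedule of `strictTinyProfile a`, `0 < a ≤ 11/648`,
is prepared in its singleton class for every push constant `c₄ ∈ (0, 1]`. [cite: Palasek2026ElementaryModel, §3.3] -/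
theorem hostPreparationD_strictTinyProfile_of_le (ha : 0 < a) (h : a ≤ 11 / 648) {c₄ : ℝ} (hc₄ : 0 < c₄)
    (hc₄' : c₄ ≤ 1) :
    HostPreparationD (HostClass.exact ((levelZeroData_strictTinyProfile_of_le ha h).schedule c₄ hc₄ hc₄')) :=
  (levelZeroData_strictTinyProfile_of_le ha h).hostPreparationD_exact hc₄ hc₄'

/-- **… and the crux for each numeric design is its episode**: `FirstEpisodeD` over the singleton class of the
germ schedule of `strictTinyProfile a` (`0 < a ≤ 11/648`) gives `EpisodeBaseG`. [cite: Palasek2026ElementaryModel, §4] -/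
theorem episodeBaseG_of_firstEpisodeD_strictTinyProfile_of_le (ha : 0 < a) (h : a ≤ 11 / 648) {c₄ : ℝ}
    (hc₄ : 0 < c₄) (hc₄' : c₄ ≤ 1)
    (hF : FirstEpisodeD (HostClass.exact ((levelZeroData_strictTinyProfile_of_le ha h).schedule c₄ hc₄ hc₄'))) :
    EpisodeBaseG :=
  (levelZeroData_strictTinyProfile_of_le ha h).episodeBaseG_of_firstEpisodeD hc₄ hc₄' hF

end Summit.NavierStokesRegularity.FluidComputer.PalasekTowerClayBridge.Germ

end
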